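import Literature.MathematicalPhysics.QuantumFieldTheory.Balaban1983to89.B8Thm2TorusKnitEstimatesOfMajorants
import Literature.MathematicalPhysics.QuantumFieldTheory.Balaban1983to89.B9Eq3104CommutatorGradFormCurl

/-!
# `Balaban1983to89.B9B8KnitBondTransfer` — JUNCTION B-LINE 3, FILE 1: the EXACT bond-sector dictionary between the [Balaban1985RegularSpaces] knit's
# periodic-`ℤ^{d+1}` carrier (bond fields `A : ℤ^{d+1} → Fin (d+1) → 𝔸`, letters `covDerivFwd`, `covDeriv`, `covLap`, `plaqCovDeriv` (3.4), `pdiv` (1.2),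
# `Jcur = D^{η*}_{U₀}D^η_{U₀}`) and def-Y's bond carrier `FBondY i → 𝔸` of a torus member (letters `cdB`, `cdsB`, `lapB`, `curlY` (3.4), `coCurlY` (3.9))
# — transfer maps, units `c_f·η`, and ★ `coCurlY U (curlY U a) = (c_fη)² · (J of the lift)`

statement-level skeleton of published theorems with citation tags; proofs where landed; nothing here is a claim about the
Yang–Mills mass gap

T. Bałaban, *Propagators for lattice gauge theories in a background field*, Commun. Math. Phys. **99** (1985) 389–434
[`Balaban1985BackgroundPropagators`, "[4]"]: (3.3) p. 390 (`D_U` on site functions), (3.4)–(3.5) p. 391 (*«(D^η_U A)(p) = η⁻¹(A(x, y) + R(U(x, y))A(y, z) +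
R(U(x, w))A(z, w) + A(w, x))»*), (3.8)–(3.9) p. 392 (the adjoints `D*`), (3.23) p. 394 (`Δ^η_U = D^{η*}_U D^η_U`), p. 390 (*«U defined on bonds of T_η»*).
T. Bałaban, *Spaces of regular gauge field configurations on a lattice and gauge fixing conditions*, Commun. Math. Phys. **99** (1985) 75–102
[`Balaban1985RegularSpaces`, "[B8]"]: (1.1)–(1.2) p. 76, (1.55) p. 86 (`J = D^{η*}_{U₀}D^η_{U₀}A`), (1.59) p. 86, p. 77 (*«we admit the case where some domains Ω_j
are equal to T_η»*).  PDFs held: `paper:balaban1985-cmp99-background-propagators`, `paper:balaban1985-cmp99-regular-spaces-gauge-fixing`.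
STATUS: published, refereed.

CITATION HEADER (lean-in-tree rule).  Cell `lit-balaban`, seat `lit-balaban-t2s-1` (gen 6), sub-row G-B8-T2S (R3 `stmt-QuantumFields-19200`, helper); B-LINE 3
of the (B)-line plan (`lit-balaban-r05/BLINE-DESIGN-r05.md` §3, lead RULING #8 (2); division r05 g86 ↔ t2s-1 g6 2026-08-28T13:44Z∕14:2xZ): the BOND-SECTOR
twin of junction J-A `B9B8CarrierDictionary` (sites).  REUSED BY NAME: J-A's `liftFun ∕ descFun ∕ liftCfg ∕ descCfg` and ★ `covDerivFwd_liftFun ∕ covDeriv_liftFun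
∕ covLap_liftFun ∕ covDeriv_liftY` (the site dictionary), def-Y's letters `cdB ∕ cdsB ∕ lapB` (`Node00.OpsYOfLetters`), `curlY ∕ coCurlY` (`Node00.OpsYDeltaA`)
through p38's component formulas `B9Eq3104CommutatorGradFormCurl.curlY_apply_eq ∕ coCurlY_apply_eq ∕ extP`, the knit's `plaqCovDeriv_eq_covDerivFwd`
(`B8Eq146AExpansion`), `pdiv` (`B8Eq143PlaqExpansion`), `Jcur` (`B8Eq155JBound`), file A2's `bgY`.

WHY THIS FILE ∕ THE ARGUMENT.  The (B)-line of the sub-row's endpoint (`B9P3PerAt`, reduced to three members by file A16 `B8Thm2TorusB9LineReduced`) is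
[B8] (1.59) for the map `A′ ↦ (J, B₁)` on the KNIT carrier, while [4] Thm 3.3's object `G(U₀) = Δ_a(U₀)⁻¹` and the (1.58) algebra (r05's
`B8Eq158AtLettersY`, B-LINE 1) live on def-Y's bond carrier `FBondY i → 𝔸` of the torus member `i = mem P₀ m′` (file A11's catalogue).  The two carriers are
ONE lattice read twice ([B8] p. 77: `T_η` as `P`-periodic data on `ℤ^{d+1}`; def-Y: the `Setup` torus `Site (PV …) 0`).  THIS FILE is the exact, estimate-free
dictionary for the BOND sector: (§1) bond-field and plaquette-field transfers (`descBd`, `liftBd`, `liftPq`) with their round trips and periodicity — J-A's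
`descFun ∕ liftFun` at the value type `Fin (d+1) → 𝔸`; (§2) def-Y's `cdB ∕ cdsB ∕ lapB` of a member bond function ARE `c_fη`, `c_fη`, `(c_fη)²` times the knit's
`covDerivFwd ∕ covDeriv ∕ covLap` of the COMPONENTS of its lift (def-Y's bond letters carry the physical unit `c_f`, the knit's the unit `η⁻¹`; J-A's site
dictionary componentwise); (§3) ★ def-Y's covariant CURL (3.4) of a member bond function IS `c_fη` × the knit's `plaqCovDeriv` of the lift (`curlY_apply_eq` +
§2 + `plaqCovDeriv_eq_covDerivFwd`), and ★ def-Y's CO-CURL (3.9) of a member plaquette function IS `c_fη` × the knit's `pdiv` (1.2) of its lift `liftPq`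
(`coCurlY_apply_eq` + `covDeriv_liftY`; the knit's `pdiv` reads only the ordered components `μ < ν`, `pdiv_congr_lt`); hence ★★ `coCurlY U (curlY U a)` at the
bond over `z` IS `(c_fη)²·J(lift a)(z)`, `J = D^{η*}D^η` (`Jcur`) — the `D*D` member of Δ_a(U) read on the knit.  §4 specialises to the sub-row's data: background
`bgY i U₀` of a `P₀`-periodic `U₀` and `descBd i A′` of a periodic `A′` (the lifts give back `U₀`, `A′`).

WHAT THIS FILE PROVES (sorry-free; definitions with bodies = the three transfer maps; everything else theorems; no estimate asserted).
* §1 `descBd`, `liftBd`, `liftPq` (+ `_apply`), `descBd_liftBd`, `liftBd_descBd` (periodic `A′`), `liftBd_periodic`, `liftPq_of_not_lt`.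
* §2 ★ `cdB_transl` ∕ `cdsB_transl` ∕ `lapB_transl`: `cdB i U ν a ⟨0 + z, κ⟩ = (c_fη) • (D^η_{U♯,ν}(a♯)_κ)(z)`, … , `lapB i U a ⟨0 + z, κ⟩ = (c_fη)² • (Δ^η_{U♯}(a♯)_κ)(z)`.
* §3 ★ `curlY_transl` (`curlY i U a ⟨0+z, μ, ν⟩ = (c_fη) • plaqCovDeriv η U♯ a♯ μ ν z`), `pdiv_congr_lt`, ★ `coCurlY_transl`
  (`coCurlY i U F ⟨0+z, κ⟩ = (c_fη) • pdiv η U♯ (liftPq F) κ z`), ★★ `coCurlY_curlY_transl` (`= (c_fη)² • Jcur η U♯ a♯ κ z`).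
* §4 the same at def-Y's bonds `b` (`z := rel 0 b.src`) and at the sub-row's data (`U := bgY i U₀`, `a := descBd i A′`, periodic `U₀`, `A′`):
  ★★ `coCurlY_curlY_descBd`, `cdB_descBd`, `lapB_descBd`.

HONEST SCOPE.  Exact finite algebra (one lattice, two carriers); NO estimate of [B8]∕[4] is proved or assumed; the averaging letters (`QY·aY·QY` ↔ the knit's
`linCovIter`, transporter choice `parB`), the Landau condition (`IsLandau138W` ↔ `RY … (divY …) = 0`) and the norms (`wNormBY` ↔ top-weight pointwise) are the
NEXT files of B-LINE 3, not here; count-neutral; `B9P3PerAt` ∕ N05 ∕ `stub_PV3A` NOT discharged; nothing continuum ∕ ℝ⁴ ∕ OS ∕ mass-gap ∕ Clay — the Yang–Mills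
mass gap is NOT proved.  No `sorry`, no `axiom`, no `… : Prop` fact, no `instance`, no `notation`.  NEW file; nothing landed is modified.  Seat `lit-balaban-t2s-1`
gen 6, 2026-08-28.
-/

noncomputable section

open scoped BigOperators

namespace Literature.MathematicalPhysics.QuantumFieldTheory.Balaban1983to89.B9B8KnitBondTransfer

open B7Prop1Explicit renaming Site → LSite
open B7Prop1Explicit (e)
open B8Ineq132 (covDerivFwd covDeriv)
open B8Eq138LandauZd (covLap covDivB)
open B8Eq146AExpansion (plaqCovDeriv plaqCovDeriv_eq_covDerivFwd pdiv_smul)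
open B8Eq143PlaqExpansion (pdiv)
open B8Eq155JBound (Jcur)
open B12Ineq417Flat (shiftCfg shiftCfg_apply)
open B10Eq27TorusAxialLog (transl transl_rel rel)
open B8Thm2SetupTorus (transl_add_period)
open B9Eq39Adjoint (R covD covDstar)
open B9BackgroundsKLevelV1 (CfgV1 shiftsV1)
open B6GlobalChartV1 (PV boxEquiv)
open B6KLevelCensusIndexV1 (KIdx)
open B9B8CarrierDictionary (liftFun liftFun_apply descFun descFun_apply liftCfg liftCfg_apply descCfg liftFun_descFun descFun_liftFun liftFun_periodic
  covDerivFwd_liftFun covDeriv_liftFun covLap_liftFun covDeriv_liftY liftCfg_descCfg)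
open B8Thm2TorusLettersPerOfKnit (bgY liftCfg_bgY)
open B9Eq3104CommutatorGradFormCurl (extP extP_chartY curlY_apply_eq coCurlY_apply_eq)
open Node00.OpsYNablaBridge (chartY chartY_eq)
open Node00

variable {d ℓ : ℕ} {hd : 1 ≤ d + 1} {hL : Odd (ℓ + 1) ∧ 1 < ℓ + 1} {b₀ b₁ : ℝ}
variable {𝔸 : Type} [NormedRing 𝔸] [NormedAlgebra ℂ 𝔸] [CompleteSpace 𝔸]
variable (i : KIdx d ℓ hd hL b₀ b₁)

/-! ## §1 Transfer maps for bond and plaquette fields -/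

section Transfer

omit [NormedRing 𝔸] [NormedAlgebra ℂ 𝔸] [CompleteSpace 𝔸] in
/-- **DESCENT OF A KNIT BOND FIELD TO THE MEMBER's BONDS**: `(A♭)(⟨y, μ⟩) = A(rel 0 y, μ)` — J-A's `descFun` at the value type `Fin (d+1) → 𝔸`, re-packaged on
`FBondY i` (positively oriented bonds `⟨y, y + e_μ⟩`, [4] p. 391 «A_μ(x) = A(x, x + ηe_μ)»). [cite: Balaban1985BackgroundPropagators, p.391; Balaban1985RegularSpaces, p.77 («Ω_j = T_η»)] -/
def descBd (A : LSite (d + 1) → Fin (d + 1) → 𝔸) : FBondY i → 𝔸 :=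
  fun b => A (rel (0 : Site (PV d ℓ i.m i.K hd hL) 0) b.src) b.dir

omit [NormedRing 𝔸] [NormedAlgebra ℂ 𝔸] [CompleteSpace 𝔸] in
/-- **PERIODIC LIFT OF A MEMBER BOND FUNCTION**: `(a♯)(z, μ) = a ⟨0 + z, μ⟩` — J-A's `liftFun` at the value type `Fin (d+1) → 𝔸`.
[cite: Balaban1985RegularSpaces, p.77 («Ω_j = T_η»), (1.3) p.77; Balaban1985BackgroundPropagators, p.391] -/
def liftBd (a : FBondY i → 𝔸) : LSite (d + 1) → Fin (d + 1) → 𝔸 :=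
  fun z μ => a ⟨transl (0 : Site (PV d ℓ i.m i.K hd hL) 0) z, μ⟩

/-- **PERIODIC LIFT OF A MEMBER PLAQUETTE FUNCTION** as the knit's ordered-pair plaquette field: `(F♯)_{μν}(z) = F(p_{μν}(0 + z))` for `μ < ν`, `0` otherwise
(the knit's `pdiv` reads only `μ < ν`) — J-A's `liftFun` of p38's components `extP F μ ν`. [cite: Balaban1985BackgroundPropagators, (3.4) p.391 («p = ⟨x, x+e_μ, x+e_μ+e_ν, x+e_ν⟩»); Balaban1985RegularSpaces, (1.2) p.76] -/
def liftPq (F : PlaqY i → 𝔸) : Fin (d + 1) → Fin (d + 1) → LSite (d + 1) → 𝔸 :=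
  fun μ ν => liftFun (P := PV d ℓ i.m i.K hd hL) (extP i F μ ν ∘ ⇑(boxEquiv i.hN))

omit [NormedRing 𝔸] [NormedAlgebra ℂ 𝔸] [CompleteSpace 𝔸] in
/-- the descent, evaluated. [cite: Balaban1985BackgroundPropagators, p.391, bookkeeping] -/
theorem descBd_apply (A : LSite (d + 1) → Fin (d + 1) → 𝔸) (b : FBondY i) :
    descBd i A b = A (rel (0 : Site (PV d ℓ i.m i.K hd hL) 0) b.src) b.dir := rfl

omit [NormedRing 𝔸] [NormedAlgebra ℂ 𝔸] [CompleteSpace 𝔸] in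
/-- the lift, evaluated. [cite: Balaban1985BackgroundPropagators, p.391, bookkeeping] -/
theorem liftBd_apply (a : FBondY i → 𝔸) (z : LSite (d + 1)) (μ : Fin (d + 1)) :
    liftBd i a z μ = a ⟨transl (0 : Site (PV d ℓ i.m i.K hd hL) 0) z, μ⟩ := rfl

omit [NormedRing 𝔸] [NormedAlgebra ℂ 𝔸] [CompleteSpace 𝔸] in
/-- the bond lift IS J-A's `liftFun` at the value type `Fin (d+1) → 𝔸`. [cite: Balaban1985RegularSpaces, p.77, dictionary] -/
theorem liftBd_eq_liftFun (a : FBondY i → 𝔸) :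
    liftBd i a = liftFun (P := PV d ℓ i.m i.K hd hL) (fun y μ => a ⟨y, μ⟩) := rfl

omit [NormedRing 𝔸] [NormedAlgebra ℂ 𝔸] [CompleteSpace 𝔸] in
/-- one component of the bond lift is J-A's `liftFun` of that component. [cite: Balaban1985RegularSpaces, p.77, dictionary] -/
theorem liftBd_comp (a : FBondY i → 𝔸) (κ : Fin (d + 1)) :
    (fun z => liftBd i a z κ) = liftFun (P := PV d ℓ i.m i.K hd hL) (fun y => a ⟨y, κ⟩) := rfl

omit [NormedAlgebra ℂ 𝔸] [CompleteSpace 𝔸] in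
/-- the plaquette lift, evaluated. [cite: Balaban1985BackgroundPropagators, (3.4) p.391, bookkeeping] -/
theorem liftPq_apply (F : PlaqY i → 𝔸) (μ ν : Fin (d + 1)) (z : LSite (d + 1)) :
    liftPq i F μ ν z = if hμν : μ < ν then F ⟨transl (0 : Site (PV d ℓ i.m i.K hd hL) 0) z, μ, ν, hμν⟩ else 0 := by
  unfold liftPq
  rw [liftFun_apply, Function.comp_apply]
  exact extP_chartY i F μ ν (transl 0 z)

omit [NormedAlgebra ℂ 𝔸] [CompleteSpace 𝔸] in
/-- the plaquette lift vanishes off the ordered pairs `μ < ν`. [cite: Balaban1985BackgroundPropagators, (3.4) p.391, bookkeeping] -/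
theorem liftPq_of_not_lt (F : PlaqY i → 𝔸) {μ ν : Fin (d + 1)} (h : ¬ μ < ν) : liftPq i F μ ν = fun _ => 0 := by
  funext z
  rw [liftPq_apply, dif_neg h]

omit [NormedRing 𝔸] [NormedAlgebra ℂ 𝔸] [CompleteSpace 𝔸] in
/-- ★ descent ∘ lift = identity on member bond functions. [cite: Balaban1985RegularSpaces, p.77 («Ω_j = T_η»)] -/
theorem descBd_liftBd (a : FBondY i → 𝔸) : descBd i (liftBd i a) = a := by
  funext b
  rw [descBd_apply, liftBd_apply, transl_rel]

omit [NormedRing 𝔸] [NormedAlgebra ℂ 𝔸] [CompleteSpace 𝔸] in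
/-- ★ lift ∘ descent = identity ON PERIODIC knit bond fields (period `P₀ = sitesPerDir 0` of the member's torus).
[cite: Balaban1985RegularSpaces, (1.3) p.77, p.77 («Ω_j = T_η»)] -/
theorem liftBd_descBd {A : LSite (d + 1) → Fin (d + 1) → 𝔸}
    (hA : ∀ (x : LSite (d + 1)) (j : Fin (d + 1)), A (x + (((PV d ℓ i.m i.K hd hL).sitesPerDir 0 : ℕ) : ℤ) • e j) = A x) :
    liftBd i (descBd i A) = A := by
  have h := liftFun_descFun (P := PV d ℓ i.m i.K hd hL) (β := Fin (d + 1) → 𝔸) hA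
  funext z μ
  have hz := congrFun h z
  rw [liftFun_apply, descFun_apply] at hz
  rw [liftBd_apply, descBd_apply]
  exact congrFun hz μ

omit [NormedRing 𝔸] [NormedAlgebra ℂ 𝔸] [CompleteSpace 𝔸] in
/-- the bond lift is periodic with the member's period in every direction. [cite: Balaban1985RegularSpaces, (1.3) p.77] -/
theorem liftBd_periodic (a : FBondY i → 𝔸) (z : LSite (d + 1)) (j : Fin (d + 1)) :
    liftBd i a (z + (((PV d ℓ i.m i.K hd hL).sitesPerDir 0 : ℕ) : ℤ) • e j) = liftBd i a z := by
  funext μ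
  rw [liftBd_apply, liftBd_apply, transl_add_period]

omit [NormedAlgebra ℂ 𝔸] [CompleteSpace 𝔸] in
/-- the plaquette lift is periodic with the member's period in every direction. [cite: Balaban1985RegularSpaces, (1.3) p.77] -/
theorem liftPq_periodic (F : PlaqY i → 𝔸) (μ ν : Fin (d + 1)) (z : LSite (d + 1)) (j : Fin (d + 1)) :
    liftPq i F μ ν (z + (((PV d ℓ i.m i.K hd hL).sitesPerDir 0 : ℕ) : ℤ) • e j) = liftPq i F μ ν z :=
  liftFun_periodic (P := PV d ℓ i.m i.K hd hL) (extP i F μ ν ∘ ⇑(boxEquiv i.hN)) z j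

end Transfer

/-! ## §2 def-Y's bond-sector covariant differences and Laplacian ARE the knit's, componentwise, in units `c_f·η` -/

section Differences

variable (η : ℝ) (U : CfgY 𝔸 i)

omit [CompleteSpace 𝔸] in
/-- the real scalar acts through `ℂ`. [folklore] -/
private theorem real_smul_eq_coe_smul (r : ℝ) (X : 𝔸) : r • X = ((r : ℂ)) • X := by
  rw [Complex.coe_smul]

/-- ★ **def-Y's `(∇_{U,ν}a)(b)` AT THE BOND OVER `z` IS `c_fη` × THE KNIT's `D^η_{U♯,ν}` OF THE COMPONENT `(a♯)_κ` AT `z`** (`b = ⟨0 + z, κ⟩`, `U♯ = liftCfg U`,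
`η ≠ 0`): [4] (3.3) on the two carriers, bond sector. [cite: Balaban1985BackgroundPropagators, (3.3) p.390, (3.39) p.397; Balaban1985RegularSpaces, (1.1) p.76] -/
theorem cdB_transl (hη : η ≠ 0) (ν : Fin (d + 1)) (a : FBondY i → 𝔸) (z : LSite (d + 1)) (κ : Fin (d + 1)) :
    cdB i U ν a ⟨transl (0 : Site (PV d ℓ i.m i.K hd hL) 0) z, κ⟩ =
      (((i.cf * η : ℝ)) : ℂ) • covDerivFwd η (liftCfg U) ν (fun w => liftBd i a w κ) z := by
  have h := covDerivFwd_liftFun (P := PV d ℓ i.m i.K hd hL) η U ν (fun y => a ⟨y, κ⟩) z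
  rw [← liftBd_comp] at h
  rw [h, real_smul_eq_coe_smul, smul_smul, Complex.ofReal_mul, mul_assoc, ← Complex.ofReal_mul, mul_inv_cancel₀ hη, Complex.ofReal_one,
    mul_one]
  rfl

/-- ★ **def-Y's `(∇*_{U,ν}a)(b)` IS `c_fη` × THE KNIT's `D^{η*}_{U♯,ν}` OF THE COMPONENT** — [4] (3.8) on the two carriers, bond sector.
[cite: Balaban1985BackgroundPropagators, (3.8) p.392; Balaban1985RegularSpaces, (1.1) p.76] -/
theorem cdsB_transl (hη : η ≠ 0) (ν : Fin (d + 1)) (a : FBondY i → 𝔸) (z : LSite (d + 1)) (κ : Fin (d + 1)) :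
    cdsB i U ν a ⟨transl (0 : Site (PV d ℓ i.m i.K hd hL) 0) z, κ⟩ =
      (((i.cf * η : ℝ)) : ℂ) • covDeriv η (liftCfg U) ν (fun w => liftBd i a w κ) z := by
  have h := covDeriv_liftFun (P := PV d ℓ i.m i.K hd hL) η U ν (fun y => a ⟨y, κ⟩) z
  rw [← liftBd_comp] at h
  rw [h, real_smul_eq_coe_smul, smul_smul, Complex.ofReal_mul, mul_assoc, ← Complex.ofReal_mul, mul_inv_cancel₀ hη, Complex.ofReal_one,
    mul_one]
  rfl

/-- the bond function `b ↦ cdB i U ν a b`, lifted, is `c_fη` × the knit's forward derivative of the component (function form of `cdB_transl`).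
[cite: Balaban1985BackgroundPropagators, (3.3) p.390, bookkeeping] -/
theorem liftBd_cdB (hη : η ≠ 0) (ν : Fin (d + 1)) (a : FBondY i → 𝔸) (κ : Fin (d + 1)) :
    (fun z => liftBd i (cdB i U ν a) z κ) = fun z => (((i.cf * η : ℝ)) : ℂ) • covDerivFwd η (liftCfg U) ν (fun w => liftBd i a w κ) z := by
  funext z
  rw [liftBd_apply, cdB_transl i η U hη]

/-- ★ **def-Y's bond Laplacian `(Δ_U a)(b) = Σ_ν ∇*_ν∇_ν` IS `(c_fη)²` × THE KNIT's `Δ^η_{U♯}` OF THE COMPONENT** — [4] (3.23) on the two carriers, bond sector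
(the `|Δ^η_{U₀}A|₍₋₃₎` member of (1.59)). [cite: Balaban1985BackgroundPropagators, (3.23) p.394; Balaban1985RegularSpaces, (1.59) p.86] -/
theorem lapB_transl (hη : η ≠ 0) (a : FBondY i → 𝔸) (z : LSite (d + 1)) (κ : Fin (d + 1)) :
    lapB i U a ⟨transl (0 : Site (PV d ℓ i.m i.K hd hL) 0) z, κ⟩ =
      (((i.cf * η : ℝ)) : ℂ) ^ 2 • covLap η (liftCfg U) (fun w => liftBd i a w κ) z := by
  unfold lapB covLap covDivB
  rw [Finset.smul_sum]
  refine Finset.sum_congr rfl fun ν _ => ?_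
  -- the outer `∇*_ν` of the bond function `cdB ν a`, then the inner `∇_ν`
  rw [cdsB_transl i η U hη ν (cdB i U ν a) z κ, liftBd_cdB i η U hη ν a κ]
  rw [show (fun w => (((i.cf * η : ℝ)) : ℂ) • covDerivFwd η (liftCfg U) ν (fun w' => liftBd i a w' κ) w)
      = (((i.cf * η : ℝ)) : ℂ) • (fun w => covDerivFwd η (liftCfg U) ν (fun w' => liftBd i a w' κ) w) from rfl]
  rw [B8Eq146AExpansion.covDeriv_smul, smul_smul, pow_two]

end Differences

/-! ## §3 ★ The covariant curl (3.4) and co-curl (3.9) on the two carriers; `coCurl ∘ curl` IS `J = D^{η*}D^η` -/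

section Curl

variable (η : ℝ) (U : CfgY 𝔸 i)

/-- ★ **def-Y's COVARIANT CURL OF A MEMBER BOND FUNCTION IS `c_fη` × THE KNIT's PLAQUETTE DERIVATIVE (3.4) OF ITS LIFT**: at the plaquette
`p_{μν}(0 + z)`, `μ < ν`: `(D_U a)(p) = (c_fη) · (D^η_{U♯} a♯)(p_{μν}(z))`. [cite: Balaban1985BackgroundPropagators, (3.4)–(3.5) p.391] -/
theorem curlY_transl (hη : η ≠ 0) (a : FBondY i → 𝔸) (z : LSite (d + 1)) {μ ν : Fin (d + 1)} (hμν : μ < ν) :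
    curlY i U a ⟨transl (0 : Site (PV d ℓ i.m i.K hd hL) 0) z, μ, ν, hμν⟩ =
      (((i.cf * η : ℝ)) : ℂ) • plaqCovDeriv η (liftCfg U) (liftBd i a) μ ν z := by
  rw [curlY_apply_eq, plaqCovDeriv_eq_covDerivFwd, smul_sub]
  exact congrArg₂ (· - ·) (cdB_transl i η U hη μ a z ν) (cdB_transl i η U hη ν a z μ)

omit [CompleteSpace 𝔸] in
/-- the knit's `pdiv` (1.2) reads a plaquette field only at the ordered pairs `μ < ν`. [cite: Balaban1985RegularSpaces, (1.2) p.76] -/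
theorem pdiv_congr_lt (V : LSite (d + 1) → Fin (d + 1) → 𝔸ˣ) {F G : Fin (d + 1) → Fin (d + 1) → LSite (d + 1) → 𝔸}
    (h : ∀ μ ν, μ < ν → F μ ν = G μ ν) (κ : Fin (d + 1)) (x : LSite (d + 1)) : pdiv η V F κ x = pdiv η V G κ x := by
  unfold pdiv
  congr 1
  · exact Finset.sum_congr rfl fun ν hν => by rw [h ν κ (Finset.mem_Iio.1 hν)]
  · exact Finset.sum_congr rfl fun ν hν => by rw [h κ ν (Finset.mem_Ioi.1 hν)]

/-- ★ **def-Y's COVARIANT CO-CURL (3.9) OF A MEMBER PLAQUETTE FUNCTION IS `c_fη` × THE KNIT's `D^{η*}_U` (1.2) OF ITS LIFT**: at the bond `⟨0 + z, κ⟩`,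
`(D*_U F)(b) = (c_fη) · (D^{η*}_{U♯} F♯)_κ(z)` — p38's component formula `coCurlY_apply_eq` (`c_f Σ_μ (∇*_μ F_{μκ} − ∇*_μ F_{κμ})`) read through J-A's
`covDeriv_liftY`; the sum over all `μ` collapses to the knit's `Σ_{μ<κ} − Σ_{μ>κ}` because the components vanish off `μ < ν`.
[cite: Balaban1985BackgroundPropagators, (3.9) p.392; Balaban1985RegularSpaces, (1.2) p.76] -/
theorem coCurlY_transl (hη : η ≠ 0) (F : PlaqY i → 𝔸) (z : LSite (d + 1)) (κ : Fin (d + 1)) :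
    coCurlY i U F ⟨transl (0 : Site (PV d ℓ i.m i.K hd hL) 0) z, κ⟩ =
      (((i.cf * η : ℝ)) : ℂ) • pdiv η (liftCfg U) (liftPq i F) κ z := by
  rw [coCurlY_apply_eq]
  -- each `cdsS` term is `η` × the knit's backward derivative of the lifted component
  have key : ∀ μ ν : Fin (d + 1), cdsS i U μ (extP i F ν κ) (chartY i (transl (0 : Site (PV d ℓ i.m i.K hd hL) 0) z)) =
      ((η : ℝ) : ℂ) • covDeriv η (liftCfg U) μ (liftPq i F ν κ) z := by
    intro μ ν
    have h := covDeriv_liftY i η U μ (extP i F ν κ) z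
    have h2 : cdsS i U μ (extP i F ν κ) (chartY i (transl (0 : Site (PV d ℓ i.m i.K hd hL) 0) z)) =
        η • covDeriv η (liftCfg U) μ (liftPq i F ν κ) z := by
      rw [show liftPq i F ν κ = liftFun (P := PV d ℓ i.m i.K hd hL) (extP i F ν κ ∘ ⇑(boxEquiv i.hN)) from rfl, h, smul_smul,
        mul_inv_cancel₀ hη, one_smul]
      rfl
    rw [h2, Complex.coe_smul]
  have key' : ∀ μ ν : Fin (d + 1), cdsS i U μ (extP i F κ ν) (chartY i (transl (0 : Site (PV d ℓ i.m i.K hd hL) 0) z)) =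
      ((η : ℝ) : ℂ) • covDeriv η (liftCfg U) μ (liftPq i F κ ν) z := by
    intro μ ν
    have h := covDeriv_liftY i η U μ (extP i F κ ν) z
    have h2 : cdsS i U μ (extP i F κ ν) (chartY i (transl (0 : Site (PV d ℓ i.m i.K hd hL) 0) z)) =
        η • covDeriv η (liftCfg U) μ (liftPq i F κ ν) z := by
      rw [show liftPq i F κ ν = liftFun (P := PV d ℓ i.m i.K hd hL) (extP i F κ ν ∘ ⇑(boxEquiv i.hN)) from rfl, h, smul_smul,
        mul_inv_cancel₀ hη, one_smul]
      rfl
    rw [h2, Complex.coe_smul]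
  simp_rw [key, key', ← smul_sub]
  rw [← Finset.smul_sum, smul_smul, ← Complex.ofReal_mul]
  congr 1
  -- the all-`μ` sum is the knit's `Σ_{μ<κ} − Σ_{μ>κ}`
  rw [Finset.sum_sub_distrib]
  unfold pdiv
  congr 1
  · symm
    refine Finset.sum_subset (Finset.subset_univ _) fun μ _ hμ => ?_
    rw [liftPq_of_not_lt i F (fun h => hμ (Finset.mem_Iio.2 h))]
    exact B8Eq138LandauZd.covDeriv_zero_fun η (liftCfg U) μ z
  · symm
    refine Finset.sum_subset (Finset.subset_univ _) fun μ _ hμ => ?_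
    rw [liftPq_of_not_lt i F (fun h => hμ (Finset.mem_Ioi.2 h))]
    exact B8Eq138LandauZd.covDeriv_zero_fun η (liftCfg U) μ z

/-- the lifted plaquette function of def-Y's curl agrees, on the ordered pairs, with `c_fη` × the knit's plaquette derivative of the lifted bond function.
[cite: Balaban1985BackgroundPropagators, (3.4) p.391, bookkeeping] -/
theorem liftPq_curlY_of_lt (hη : η ≠ 0) (a : FBondY i → 𝔸) {μ ν : Fin (d + 1)} (hμν : μ < ν) :
    liftPq i (curlY i U a) μ ν = ((((i.cf * η : ℝ)) : ℂ) • plaqCovDeriv η (liftCfg U) (liftBd i a)) μ ν := by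
  funext z
  rw [liftPq_apply, dif_pos hμν, curlY_transl i η U hη a z hμν]
  rfl

/-- ★★ **`D*_U D_U` ON THE TWO CARRIERS: def-Y's `coCurlY U (curlY U a)` AT THE BOND OVER `z` IS `(c_fη)²·J(a♯)_κ(z)`**, `J = D^{η*}_{U♯}D^η_{U♯}` the knit's
`Jcur` ((1.55)) — the `D*D` member of `Δ_a(U)` ([4] (3.26), via (3.10) `Δ(U) = D*D + Δ′`) read on the knit's carrier.
[cite: Balaban1985RegularSpaces, (1.55) p.86, (1.58)–(1.59) p.86; Balaban1985BackgroundPropagators, (3.4) p.391, (3.9)–(3.10) p.392, (3.26) p.395] -/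
theorem coCurlY_curlY_transl (hη : η ≠ 0) (a : FBondY i → 𝔸) (z : LSite (d + 1)) (κ : Fin (d + 1)) :
    coCurlY i U (curlY i U a) ⟨transl (0 : Site (PV d ℓ i.m i.K hd hL) 0) z, κ⟩ =
      (((i.cf * η : ℝ)) : ℂ) ^ 2 • Jcur η (liftCfg U) (liftBd i a) κ z := by
  rw [coCurlY_transl i η U hη, B8Eq155JBound.Jcur_def,
    pdiv_congr_lt η (liftCfg U) (fun μ ν h => liftPq_curlY_of_lt i η U hη a h) κ z, pdiv_smul, smul_smul, pow_two]

end Curl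

/-! ## §4 At def-Y's bonds, and at the sub-row's data (`bgY i U₀`, `descBd i A′`) -/

section SubRow

variable (η : ℝ)

/-- every bond of the member is the bond over its representative: `b = ⟨0 + rel 0 b₋, b.dir⟩`. [cite: Balaban1985RegularSpaces, p.77, bookkeeping] -/
theorem bond_eq_transl_rel (b : FBondY i) : b = ⟨transl (0 : Site (PV d ℓ i.m i.K hd hL) 0) (rel 0 b.src), b.dir⟩ := by
  obtain ⟨y, μ⟩ := b
  simp only [transl_rel]

/-- ★★ `coCurlY U (curlY U a) b = (c_fη)²·J(a♯)_{b.dir}(rel 0 b₋)` at every member bond. [cite: Balaban1985RegularSpaces, (1.55), (1.58) p.86; Balaban1985BackgroundPropagators, (3.4), (3.9) pp.391–392] -/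
theorem coCurlY_curlY_apply (hη : η ≠ 0) (U : CfgY 𝔸 i) (a : FBondY i → 𝔸) (b : FBondY i) :
    coCurlY i U (curlY i U a) b =
      (((i.cf * η : ℝ)) : ℂ) ^ 2 • Jcur η (liftCfg U) (liftBd i a) b.dir (rel (0 : Site (PV d ℓ i.m i.K hd hL) 0) b.src) := by
  conv_lhs => rw [bond_eq_transl_rel i b]
  exact coCurlY_curlY_transl i η U hη a _ b.dir

/-- `cdB i U ν a b = (c_fη)·(D^η_{U♯,ν}(a♯)_{b.dir})(rel 0 b₋)` at every member bond. [cite: Balaban1985BackgroundPropagators, (3.3) p.390] -/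
theorem cdB_apply_rel (hη : η ≠ 0) (U : CfgY 𝔸 i) (ν : Fin (d + 1)) (a : FBondY i → 𝔸) (b : FBondY i) :
    cdB i U ν a b = (((i.cf * η : ℝ)) : ℂ) • covDerivFwd η (liftCfg U) ν (fun w => liftBd i a w b.dir) (rel (0 : Site (PV d ℓ i.m i.K hd hL) 0) b.src) := by
  conv_lhs => rw [bond_eq_transl_rel i b]
  exact cdB_transl i η U hη ν a _ b.dir

/-- `lapB i U a b = (c_fη)²·(Δ^η_{U♯}(a♯)_{b.dir})(rel 0 b₋)` at every member bond. [cite: Balaban1985BackgroundPropagators, (3.23) p.394] -/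
theorem lapB_apply_rel (hη : η ≠ 0) (U : CfgY 𝔸 i) (a : FBondY i → 𝔸) (b : FBondY i) :
    lapB i U a b = (((i.cf * η : ℝ)) : ℂ) ^ 2 • covLap η (liftCfg U) (fun w => liftBd i a w b.dir) (rel (0 : Site (PV d ℓ i.m i.K hd hL) 0) b.src) := by
  conv_lhs => rw [bond_eq_transl_rel i b]
  exact lapB_transl i η U hη a _ b.dir

/-- ★★ **AT THE SUB-ROW's DATA**: for a `P₀`-periodic background `U₀` and a `P₀`-periodic knit bond field `A′` (`P₀` the member's period), def-Y's
`coCurlY (curlY (A′♭))` at the member background `bgY i U₀` IS `(c_fη)²·J(A′)` — `J = D^{η*}_{U₀}D^η_{U₀}A′` the (1.55) current of the (B)-line — at the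
representative of every bond. [cite: Balaban1985RegularSpaces, (1.55), (1.58)–(1.59) p.86, p.77; Balaban1985BackgroundPropagators, (3.4), (3.9) pp.391–392, (3.26) p.395] -/
theorem coCurlY_curlY_descBd (hη : η ≠ 0) {U₀ : LSite (d + 1) → Fin (d + 1) → 𝔸ˣ}
    (hU₀ : ∀ μ : Fin (d + 1), shiftCfg ((((PV d ℓ i.m i.K hd hL).sitesPerDir 0 : ℕ) : ℤ) • e μ) U₀ = U₀)
    {A' : LSite (d + 1) → Fin (d + 1) → 𝔸}
    (hA' : ∀ (x : LSite (d + 1)) (j : Fin (d + 1)), A' (x + (((PV d ℓ i.m i.K hd hL).sitesPerDir 0 : ℕ) : ℤ) • e j) = A' x) (b : FBondY i) :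
    coCurlY i (bgY i U₀) (curlY i (bgY i U₀) (descBd i A')) b =
      (((i.cf * η : ℝ)) : ℂ) ^ 2 • Jcur η U₀ A' b.dir (rel (0 : Site (PV d ℓ i.m i.K hd hL) 0) b.src) := by
  rw [coCurlY_curlY_apply i η hη, liftCfg_bgY i hU₀, liftBd_descBd i hA']

/-- the `cdB` member at the sub-row's data: `cdB (bgY U₀) ν (A′♭) b = (c_fη)·(D^η_{U₀,ν}A′_{b.dir})(rel 0 b₋)`. [cite: Balaban1985BackgroundPropagators, (3.3) p.390; Balaban1985RegularSpaces, (1.1) p.76, (1.59) p.86] -/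
theorem cdB_descBd (hη : η ≠ 0) {U₀ : LSite (d + 1) → Fin (d + 1) → 𝔸ˣ}
    (hU₀ : ∀ μ : Fin (d + 1), shiftCfg ((((PV d ℓ i.m i.K hd hL).sitesPerDir 0 : ℕ) : ℤ) • e μ) U₀ = U₀)
    {A' : LSite (d + 1) → Fin (d + 1) → 𝔸}
    (hA' : ∀ (x : LSite (d + 1)) (j : Fin (d + 1)), A' (x + (((PV d ℓ i.m i.K hd hL).sitesPerDir 0 : ℕ) : ℤ) • e j) = A' x)
    (ν : Fin (d + 1)) (b : FBondY i) :
    cdB i (bgY i U₀) ν (descBd i A') b =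
      (((i.cf * η : ℝ)) : ℂ) • covDerivFwd η U₀ ν (fun w => A' w b.dir) (rel (0 : Site (PV d ℓ i.m i.K hd hL) 0) b.src) := by
  rw [cdB_apply_rel i η hη, liftCfg_bgY i hU₀, liftBd_descBd i hA']

/-- the Laplacian member at the sub-row's data: `lapB (bgY U₀) (A′♭) b = (c_fη)²·(Δ^η_{U₀}A′_{b.dir})(rel 0 b₋)`. [cite: Balaban1985BackgroundPropagators, (3.23) p.394; Balaban1985RegularSpaces, (1.59) p.86] -/
theorem lapB_descBd (hη : η ≠ 0) {U₀ : LSite (d + 1) → Fin (d + 1) → 𝔸ˣ}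
    (hU₀ : ∀ μ : Fin (d + 1), shiftCfg ((((PV d ℓ i.m i.K hd hL).sitesPerDir 0 : ℕ) : ℤ) • e μ) U₀ = U₀)
    {A' : LSite (d + 1) → Fin (d + 1) → 𝔸}
    (hA' : ∀ (x : LSite (d + 1)) (j : Fin (d + 1)), A' (x + (((PV d ℓ i.m i.K hd hL).sitesPerDir 0 : ℕ) : ℤ) • e j) = A' x) (b : FBondY i) :
    lapB i (bgY i U₀) (descBd i A') b =
      (((i.cf * η : ℝ)) : ℂ) ^ 2 • covLap η U₀ (fun w => A' w b.dir) (rel (0 : Site (PV d ℓ i.m i.K hd hL) 0) b.src) := by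
  rw [lapB_apply_rel i η hη, liftCfg_bgY i hU₀, liftBd_descBd i hA']

end SubRow

end Literature.MathematicalPhysics.QuantumFieldTheory.Balaban1983to89.B9B8KnitBondTransfer

end
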